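import Mathlib.Analysis.SpecialFunctions.Pow.Real
import Mathlib.Algebra.Order.Chebyshev
import Mathlib.Algebra.BigOperators.Field
import HarnessLib

/-!
# Route `UnitScaleTilt`, crux K1 «MinimiserStabilityRegPr» (stmt-QuantumFields-19200), EX row `hGF` (curved member), the LOD line (★p1 g24 `LOCATE-L6-ASSEMBLY` §1 Step I.1,
# v1.1 «CUTOFFS»; w5 g13 spec (χ1)–(χ4) of record, 2026-08-29) — **PEN (L6-χ), FILE A: THE SQUARES NORMALISATION `χ = ζ∕√N` OF A FINITE FAMILY — PURE REAL ALGEBRA.**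

Cell `ym3-torus` (HUMAN RULING D-0037: YM₃ on T³ is ladder rung R3 — NOT d = 4, NOT infinite volume, NOT a mass gap, NOT Clay).  Width seat `ym3-torus-px17` (gen 8);
memo `LOCATE-L6chi-px17g8.md` (19200 evidence).  THEOREMS ONLY (0 `def`, 0 `sorry`); `--supports stmt-QuantumFields-19200 --as helper`, count-neutral.  HONEST LABEL
(№33 (6)): real-number bookkeeping feeding FILE B `…Prop7LODCutoffLetters.exists_sqPartition`; nothing of Bałaban's estimates, (L5x), (L6), `hGF`, `h349`, EX or the crux.

THE MATHEMATICS.  A family `ζ_c ∈ [0,1]` on a finite index set with `Σ_c ζ_c = 1` and at most `k` nonzero terms has `N := Σ_c ζ_c² ∈ [1∕k, 1]` (Cauchy–Schwarz on the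
alive set; `ζ² ≤ ζ`), so `χ_c := ζ_c∕√N` is a QUADRATIC partition `Σ_c χ_c² = 1`, `0 ≤ χ_c ≤ 1`, with the same supports.  If a second such family `ζ′` has `|ζ′_c − ζ_c| ≤ a`
termwise then `|N − N′| ≤ 2a`, `|1∕√N′ − 1∕√N| ≤ |N − N′|∕(2m√m)` (`m = 1∕k`), hence the LIPSCHITZ ROWS, quadratic in `a` (which is what keeps the member's currency K-free):
per index `|χ′_c − χ_c| ≤ (√k + k√k)·a`, and over the family `Σ_c (χ′_c − χ_c)² ≤ (4k² + 2k³)·a²` (only the `≤ 2k` indices alive in one of the two families contribute).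

WHAT IS PROVED (ns `…Theorems.Prop7LODCutoffRealFamily`): `sum_sq_le_sum`, ★`one_le_card_mul_sum_sq`, `abs_inv_sqrt_sub_inv_sqrt_le`, `sum_div_sqrt_sq_eq_one`,
`div_sqrt_mem_unitInterval`, `sq_le_sum_sq`, `abs_sum_sq_sub_sum_sq_le`, `sum_sq_sub_le_card`, ★★`abs_div_sqrt_sub_div_sqrt_le`, ★★`sum_sq_div_sqrt_sub_div_sqrt_le`.

References: T. Bałaban, CMP **99** (1985) 389–434 [Balaban1985BackgroundPropagators] ((3.100) pp.413–414: smooth partitions of the block lattice); CMP **96** (1984) 223–250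
[Balaban1984PropagatorsII] (§1); B. Simon, Ann. IHP A **38** (1983) 295–308 (IMS localisation with `Σχ² = 1`).
-/

set_option autoImplicit false

noncomputable section

open scoped BigOperators

namespace Summit.QuantumFields.YangMills.Theorems.Prop7LODCutoffRealFamily

/-! ## §A The squares normalisation `χ = ζ ∕ √N`, `N = Σ_c ζ_c²` — pure real algebra over a finite family -/

section RealFamily

variable {ι : Type*} (s : Finset ι)

/-- `0 ≤ ζ ≤ 1` termwise ⟹ `Σ ζ² ≤ Σ ζ`. [folklore] -/
theorem sum_sq_le_sum (ζ : ι → ℝ) (h01 : ∀ c ∈ s, 0 ≤ ζ c ∧ ζ c ≤ 1) :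
    ∑ c ∈ s, ζ c ^ 2 ≤ ∑ c ∈ s, ζ c :=
  Finset.sum_le_sum fun c hc => by
    have := h01 c hc; rw [sq]; exact mul_le_of_le_one_left this.1 this.2

/-- **ALIVE COUNT ⟹ `N ≥ 1∕k`**: if `Σ_s ζ = 1` and at most `k` of the `ζ_c` are nonzero then `1 ≤ k·Σ_s ζ_c²` (Cauchy–Schwarz on the alive set).
[cite: Balaban1985BackgroundPropagators, (3.100) pp.413-414] -/
theorem one_le_card_mul_sum_sq [DecidableEq ι] (ζ : ι → ℝ) (hsum : ∑ c ∈ s, ζ c = 1) {k : ℕ}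
    (hk : (s.filter fun c => ζ c ≠ 0).card ≤ k) :
    1 ≤ (k : ℝ) * ∑ c ∈ s, ζ c ^ 2 := by
  classical
  set A := s.filter fun c => ζ c ≠ 0 with hA
  have hsumA : ∑ c ∈ A, ζ c = 1 := by rw [hA, Finset.sum_filter_ne_zero, hsum]
  have hsqA : ∑ c ∈ A, ζ c ^ 2 ≤ ∑ c ∈ s, ζ c ^ 2 :=
    Finset.sum_le_sum_of_subset_of_nonneg (Finset.filter_subset _ _) fun c _ _ => sq_nonneg _
  have hcs : (∑ c ∈ A, ζ c * 1) ^ 2 ≤ (∑ c ∈ A, ζ c ^ 2) * ∑ c ∈ A, (1 : ℝ) ^ 2 :=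
    Finset.sum_mul_sq_le_sq_mul_sq A ζ (fun _ => 1)
  simp only [mul_one, one_pow, Finset.sum_const, nsmul_eq_mul, hsumA] at hcs
  have hcard : ((A.card : ℕ) : ℝ) ≤ k := by exact_mod_cast hk
  have h0 : 0 ≤ ∑ c ∈ A, ζ c ^ 2 := Finset.sum_nonneg fun _ _ => sq_nonneg _
  calc (1 : ℝ) ≤ (∑ c ∈ A, ζ c ^ 2) * A.card := by simpa [mul_comm] using hcs
    _ ≤ (∑ c ∈ s, ζ c ^ 2) * k := mul_le_mul hsqA hcard (Nat.cast_nonneg _) (h0.trans hsqA)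
    _ = (k : ℝ) * ∑ c ∈ s, ζ c ^ 2 := mul_comm _ _

/-- `|1∕√N′ − 1∕√N| ≤ |N − N′|∕(2m√m)` for `N, N′ ≥ m > 0`. [folklore] -/
theorem abs_inv_sqrt_sub_inv_sqrt_le {m N N' : ℝ} (hm : 0 < m) (hN : m ≤ N) (hN' : m ≤ N') :
    |(Real.sqrt N')⁻¹ - (Real.sqrt N)⁻¹| ≤ |N - N'| / (2 * m * Real.sqrt m) := by
  have hNp : 0 < N := hm.trans_le hN
  have hN'p : 0 < N' := hm.trans_le hN'
  have hsN : 0 < Real.sqrt N := Real.sqrt_pos.mpr hNp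
  have hsN' : 0 < Real.sqrt N' := Real.sqrt_pos.mpr hN'p
  have hsm : 0 < Real.sqrt m := Real.sqrt_pos.mpr hm
  have hmN : Real.sqrt m ≤ Real.sqrt N := Real.sqrt_le_sqrt hN
  have hmN' : Real.sqrt m ≤ Real.sqrt N' := Real.sqrt_le_sqrt hN'
  -- `1/√N′ − 1/√N = (N − N′) / (√N √N′ (√N + √N′))`
  have hkey : (Real.sqrt N')⁻¹ - (Real.sqrt N)⁻¹ = (N - N') / (Real.sqrt N * Real.sqrt N' * (Real.sqrt N + Real.sqrt N')) := by
    have h1 : Real.sqrt N * Real.sqrt N = N := Real.mul_self_sqrt hNp.le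
    have h2 : Real.sqrt N' * Real.sqrt N' = N' := Real.mul_self_sqrt hN'p.le
    field_simp
    nlinarith [h1, h2]
  have hden : 2 * m * Real.sqrt m ≤ Real.sqrt N * Real.sqrt N' * (Real.sqrt N + Real.sqrt N') := by
    have hmm : Real.sqrt m * Real.sqrt m = m := Real.mul_self_sqrt hm.le
    have : Real.sqrt m * Real.sqrt m * (Real.sqrt m + Real.sqrt m) ≤ Real.sqrt N * Real.sqrt N' * (Real.sqrt N + Real.sqrt N') := by
      gcongr
    nlinarith [this, hmm]
  rw [hkey, abs_div, abs_of_pos (by positivity : 0 < Real.sqrt N * Real.sqrt N' * (Real.sqrt N + Real.sqrt N'))]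
  exact div_le_div_of_nonneg_left (abs_nonneg _) (by positivity) hden

/-- `Σ_s (ζ_c∕√N)² = 1` when `N = Σ_s ζ_c² > 0`. [folklore] -/
theorem sum_div_sqrt_sq_eq_one (ζ : ι → ℝ) {N : ℝ} (hN : 0 < N) (hdef : ∑ c ∈ s, ζ c ^ 2 = N) :
    ∑ c ∈ s, (ζ c / Real.sqrt N) ^ 2 = 1 := by
  simp only [div_pow, Real.sq_sqrt hN.le]
  rw [← Finset.sum_div, hdef, div_self hN.ne']

/-- `0 ≤ ζ_c∕√N ≤ 1` when `0 ≤ ζ_c` and `ζ_c² ≤ N`. [folklore] -/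
theorem div_sqrt_mem_unitInterval {z N : ℝ} (hz : 0 ≤ z) (hN : 0 < N) (hle : z ^ 2 ≤ N) :
    0 ≤ z / Real.sqrt N ∧ z / Real.sqrt N ≤ 1 := by
  have hs : 0 < Real.sqrt N := Real.sqrt_pos.mpr hN
  refine ⟨div_nonneg hz hs.le, ?_⟩
  rw [div_le_one hs]
  exact Real.le_sqrt_of_sq_le hle

/-- one term of a family is below the family sum of squares: `ζ_c² ≤ Σ_s ζ²` (`c ∈ s`). [folklore] -/
theorem sq_le_sum_sq (ζ : ι → ℝ) {c : ι} (hc : c ∈ s) : ζ c ^ 2 ≤ ∑ c' ∈ s, ζ c' ^ 2 :=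
  Finset.single_le_sum (fun c' _ => sq_nonneg (ζ c')) hc

/-- **`|N − N′| ≤ 2a`**: two nonnegative families with `Σζ = Σζ′ = 1` and `|ζ′_c − ζ_c| ≤ a` have `|Σζ² − Σζ′²| ≤ 2a`. [folklore] -/
theorem abs_sum_sq_sub_sum_sq_le (ζ ζ' : ι → ℝ) (h0 : ∀ c ∈ s, 0 ≤ ζ c) (h0' : ∀ c ∈ s, 0 ≤ ζ' c)
    (hsum : ∑ c ∈ s, ζ c = 1) (hsum' : ∑ c ∈ s, ζ' c = 1) {a : ℝ} (ha : ∀ c ∈ s, |ζ' c - ζ c| ≤ a) :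
    |∑ c ∈ s, ζ c ^ 2 - ∑ c ∈ s, ζ' c ^ 2| ≤ 2 * a := by
  rw [← Finset.sum_sub_distrib]
  refine (Finset.abs_sum_le_sum_abs _ _).trans ?_
  have hterm : ∀ c ∈ s, |ζ c ^ 2 - ζ' c ^ 2| ≤ a * (ζ c + ζ' c) := by
    intro c hc
    rw [sq_sub_sq, abs_mul, abs_of_nonneg (add_nonneg (h0 c hc) (h0' c hc)), abs_sub_comm, mul_comm]
    exact mul_le_mul_of_nonneg_right (ha c hc) (add_nonneg (h0 c hc) (h0' c hc))
  refine (Finset.sum_le_sum hterm).trans ?_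
  rw [← Finset.mul_sum, Finset.sum_add_distrib, hsum, hsum']
  linarith

/-- **`Σ_s (ζ′ − ζ)² ≤ 2k·a²`** when each family has at most `k` nonzero terms and `|ζ′_c − ζ_c| ≤ a` (only indices alive in one of the two families contribute).
[folklore] -/
theorem sum_sq_sub_le_card [DecidableEq ι] (ζ ζ' : ι → ℝ) {k : ℕ} (hk : (s.filter fun c => ζ c ≠ 0).card ≤ k)
    (hk' : (s.filter fun c => ζ' c ≠ 0).card ≤ k) {a : ℝ} (ha : ∀ c ∈ s, |ζ' c - ζ c| ≤ a) :
    ∑ c ∈ s, (ζ' c - ζ c) ^ 2 ≤ 2 * k * a ^ 2 := by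
  classical
  set A := s.filter fun c => ζ c ≠ 0 ∨ ζ' c ≠ 0 with hA
  have hzero : ∀ c ∈ s, c ∉ A → (ζ' c - ζ c) ^ 2 = 0 := by
    intro c hc hcA
    simp only [hA, Finset.mem_filter, not_and, not_or, not_not] at hcA
    obtain ⟨h1, h2⟩ := hcA hc
    rw [h1, h2, sub_zero, zero_pow two_ne_zero]
  rw [← Finset.sum_subset (Finset.filter_subset _ s) (fun c hc hcA => hzero c hc hcA)]
  have hcardA : (A.card : ℝ) ≤ 2 * k := by
    have hsub : A ⊆ (s.filter fun c => ζ c ≠ 0) ∪ (s.filter fun c => ζ' c ≠ 0) := by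
      intro c hc
      simp only [hA, Finset.mem_filter, Finset.mem_union] at hc ⊢
      rcases hc.2 with h | h
      · exact Or.inl ⟨hc.1, h⟩
      · exact Or.inr ⟨hc.1, h⟩
    have h1 := (Finset.card_le_card hsub).trans (Finset.card_union_le _ _)
    have : (A.card : ℝ) ≤ ((s.filter fun c => ζ c ≠ 0).card : ℝ) + ((s.filter fun c => ζ' c ≠ 0).card : ℝ) := by exact_mod_cast h1
    have h2 : (((s.filter fun c => ζ c ≠ 0).card : ℕ) : ℝ) ≤ k := by exact_mod_cast hk
    have h3 : (((s.filter fun c => ζ' c ≠ 0).card : ℕ) : ℝ) ≤ k := by exact_mod_cast hk'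
    linarith
  have hterm : ∀ c ∈ A, (ζ' c - ζ c) ^ 2 ≤ a ^ 2 := by
    intro c hc
    have hcs : c ∈ s := (Finset.mem_filter.mp hc).1
    rw [← sq_abs]
    exact pow_le_pow_left₀ (abs_nonneg _) (ha c hcs) 2
  refine (Finset.sum_le_sum hterm).trans ?_
  rw [Finset.sum_const, nsmul_eq_mul]
  nlinarith [sq_nonneg a]

/-- ★ **THE PER-INDEX LIPSCHITZ ROW OF `χ = ζ∕√N`**: with `N, N′ ≥ 1∕k`, `N ≤ 1`... precisely: `0 ≤ ζ_c ≤ 1`, `|ζ′_c − ζ_c| ≤ a`, `1∕k ≤ N, N′`, `|N − N′| ≤ 2a` ⟹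
`|ζ′_c∕√N′ − ζ_c∕√N| ≤ (√k + k√k)·a`. [cite: Balaban1985BackgroundPropagators, (3.100) pp.413-414] -/
theorem abs_div_sqrt_sub_div_sqrt_le {z z' N N' a : ℝ} {k : ℕ} (hk : 0 < k) (hz : 0 ≤ z ∧ z ≤ 1) (hzz : |z' - z| ≤ a)
    (hN : (k : ℝ)⁻¹ ≤ N) (hN' : (k : ℝ)⁻¹ ≤ N') (hNN : |N - N'| ≤ 2 * a) :
    |z' / Real.sqrt N' - z / Real.sqrt N| ≤ (Real.sqrt k + k * Real.sqrt k) * a := by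
  have hkpos : (0 : ℝ) < k := by exact_mod_cast hk
  have hm : (0 : ℝ) < (k : ℝ)⁻¹ := inv_pos.mpr hkpos
  have hN'p : 0 < N' := hm.trans_le hN'
  have hsN' : 0 < Real.sqrt N' := Real.sqrt_pos.mpr hN'p
  have ha0 : 0 ≤ a := (abs_nonneg _).trans hzz
  -- split: `z'/√N' − z/√N = (z' − z)/√N' + z·(1/√N' − 1/√N)`
  have hsplit : z' / Real.sqrt N' - z / Real.sqrt N = (z' - z) * (Real.sqrt N')⁻¹ + z * ((Real.sqrt N')⁻¹ - (Real.sqrt N)⁻¹) := by ring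
  rw [hsplit]
  refine (abs_add_le _ _).trans ?_
  rw [abs_mul, abs_mul, abs_of_nonneg hz.1, abs_of_pos (inv_pos.mpr hsN')]
  -- `1/√N' ≤ √k`
  have hinvN' : (Real.sqrt N')⁻¹ ≤ Real.sqrt k := by
    rw [inv_le_comm₀ hsN' (Real.sqrt_pos.mpr hkpos), ← Real.sqrt_inv]
    exact Real.sqrt_le_sqrt hN'
  -- `|1/√N' − 1/√N| ≤ 2a / (2 m √m) = k√k · a`
  have hdiff := abs_inv_sqrt_sub_inv_sqrt_le hm hN hN'
  have hsqm : Real.sqrt ((k : ℝ)⁻¹) = (Real.sqrt k)⁻¹ := Real.sqrt_inv _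
  have hsk : 0 < Real.sqrt k := Real.sqrt_pos.mpr hkpos
  have hskk : Real.sqrt k * Real.sqrt k = k := Real.mul_self_sqrt hkpos.le
  have hdiff' : |(Real.sqrt N')⁻¹ - (Real.sqrt N)⁻¹| ≤ k * Real.sqrt k * a := by
    refine hdiff.trans ?_
    rw [hsqm, div_le_iff₀ (by positivity)]
    calc |N - N'| ≤ 2 * a := hNN
      _ = k * Real.sqrt k * a * (2 * (k : ℝ)⁻¹ * (Real.sqrt k)⁻¹) := by field_simp
  calc |z' - z| * (Real.sqrt N')⁻¹ + z * |(Real.sqrt N')⁻¹ - (Real.sqrt N)⁻¹|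
      ≤ a * Real.sqrt k + 1 * (k * Real.sqrt k * a) := by
        gcongr
        · exact hz.2
    _ = (Real.sqrt k + k * Real.sqrt k) * a := by ring

/-- ★ **THE FAMILY LIPSCHITZ ROW OF `χ = ζ∕√N`**: `Σ_s (ζ′_c∕√N′ − ζ_c∕√N)² ≤ (4k² + 2k³)·a²` for two `[0,1]`-valued families with `Σζ = Σζ′ = 1`, at most `k` alive
terms each, `|ζ′_c − ζ_c| ≤ a`, `N = Σζ²`, `N′ = Σζ′²`. [cite: Balaban1985BackgroundPropagators, (3.100) pp.413-414] -/
theorem sum_sq_div_sqrt_sub_div_sqrt_le [DecidableEq ι] (ζ ζ' : ι → ℝ) {k : ℕ} (hk0 : 0 < k)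
    (h01 : ∀ c ∈ s, 0 ≤ ζ c ∧ ζ c ≤ 1) (h01' : ∀ c ∈ s, 0 ≤ ζ' c ∧ ζ' c ≤ 1)
    (hsum : ∑ c ∈ s, ζ c = 1) (hsum' : ∑ c ∈ s, ζ' c = 1)
    (hk : (s.filter fun c => ζ c ≠ 0).card ≤ k) (hk' : (s.filter fun c => ζ' c ≠ 0).card ≤ k)
    {a : ℝ} (ha : ∀ c ∈ s, |ζ' c - ζ c| ≤ a) {N N' : ℝ} (hN : ∑ c ∈ s, ζ c ^ 2 = N) (hN' : ∑ c ∈ s, ζ' c ^ 2 = N') :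
    ∑ c ∈ s, (ζ' c / Real.sqrt N' - ζ c / Real.sqrt N) ^ 2 ≤ (4 * (k : ℝ) ^ 2 + 2 * (k : ℝ) ^ 3) * a ^ 2 := by
  have hkpos : (0 : ℝ) < k := by exact_mod_cast hk0
  have hm : (0 : ℝ) < (k : ℝ)⁻¹ := inv_pos.mpr hkpos
  -- `1/k ≤ N, N' ≤ 1`
  have hNlo : (k : ℝ)⁻¹ ≤ N := by
    have h := one_le_card_mul_sum_sq s ζ hsum hk
    rw [hN] at h
    rw [inv_le_iff_one_le_mul₀ hkpos]; linarith [mul_comm (k : ℝ) N]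
  have hN'lo : (k : ℝ)⁻¹ ≤ N' := by
    have h := one_le_card_mul_sum_sq s ζ' hsum' hk'
    rw [hN'] at h
    rw [inv_le_iff_one_le_mul₀ hkpos]; linarith [mul_comm (k : ℝ) N']
  have hNhi : N ≤ 1 := by rw [← hN, ← hsum]; exact sum_sq_le_sum s ζ h01
  have hNp : 0 < N := hm.trans_le hNlo
  have hN'p : 0 < N' := hm.trans_le hN'lo
  have hsN' : 0 < Real.sqrt N' := Real.sqrt_pos.mpr hN'p
  have ha0 : 0 ≤ a := by
    by_cases hs : s.Nonempty
    · obtain ⟨c, hc⟩ := hs; exact (abs_nonneg _).trans (ha c hc)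
    · rw [Finset.not_nonempty_iff_eq_empty] at hs; rw [hs, Finset.sum_empty] at hsum; exact absurd hsum zero_ne_one
  -- `|N − N'| ≤ 2a` and the inverse-square-root difference
  have hNN : |N - N'| ≤ 2 * a := by
    rw [← hN, ← hN']; exact abs_sum_sq_sub_sum_sq_le s ζ ζ' (fun c hc => (h01 c hc).1) (fun c hc => (h01' c hc).1) hsum hsum' ha
  set D : ℝ := (Real.sqrt N')⁻¹ - (Real.sqrt N)⁻¹ with hD
  have hsk : 0 < Real.sqrt k := Real.sqrt_pos.mpr hkpos
  have hskk : Real.sqrt k * Real.sqrt k = k := Real.mul_self_sqrt hkpos.le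
  have hDle : |D| ≤ k * Real.sqrt k * a := by
    refine (abs_inv_sqrt_sub_inv_sqrt_le hm hNlo hN'lo).trans ?_
    rw [Real.sqrt_inv, div_le_iff₀ (by positivity)]
    calc |N - N'| ≤ 2 * a := hNN
      _ = k * Real.sqrt k * a * (2 * (k : ℝ)⁻¹ * (Real.sqrt k)⁻¹) := by field_simp
  have hD2 : D ^ 2 ≤ (k : ℝ) ^ 3 * a ^ 2 := by
    have h1 : D ^ 2 ≤ (k * Real.sqrt k * a) ^ 2 := by rw [← sq_abs]; exact pow_le_pow_left₀ (abs_nonneg _) hDle 2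
    have h2 : (k * Real.sqrt k * a) ^ 2 = (k : ℝ) ^ 3 * a ^ 2 := by
      have : Real.sqrt (k : ℝ) ^ 2 = k := Real.sq_sqrt hkpos.le
      calc (k * Real.sqrt k * a) ^ 2 = (k : ℝ) ^ 2 * Real.sqrt (k : ℝ) ^ 2 * a ^ 2 := by ring
        _ = (k : ℝ) ^ 3 * a ^ 2 := by rw [this]; ring
    exact h1.trans_eq h2
  -- termwise split `(u + v)² ≤ 2u² + 2v²`
  have hterm : ∀ c ∈ s, (ζ' c / Real.sqrt N' - ζ c / Real.sqrt N) ^ 2 ≤ 2 * ((N')⁻¹ * (ζ' c - ζ c) ^ 2) + 2 * (D ^ 2 * ζ c ^ 2) := by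
    intro c _
    have hsplit : ζ' c / Real.sqrt N' - ζ c / Real.sqrt N = (ζ' c - ζ c) * (Real.sqrt N')⁻¹ + D * ζ c := by rw [hD]; ring
    have hinv2 : ((Real.sqrt N')⁻¹) ^ 2 = (N')⁻¹ := by rw [inv_pow, Real.sq_sqrt hN'p.le]
    rw [hsplit]
    calc ((ζ' c - ζ c) * (Real.sqrt N')⁻¹ + D * ζ c) ^ 2 ≤ 2 * ((ζ' c - ζ c) * (Real.sqrt N')⁻¹) ^ 2 + 2 * (D * ζ c) ^ 2 := by
          nlinarith [sq_nonneg ((ζ' c - ζ c) * (Real.sqrt N')⁻¹ - D * ζ c)]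
      _ = 2 * ((N')⁻¹ * (ζ' c - ζ c) ^ 2) + 2 * (D ^ 2 * ζ c ^ 2) := by rw [mul_pow, mul_pow, hinv2]; ring
  refine (Finset.sum_le_sum hterm).trans ?_
  rw [Finset.sum_add_distrib, ← Finset.mul_sum, ← Finset.mul_sum, ← Finset.mul_sum, ← Finset.mul_sum, hN]
  -- the two pieces
  have hinvN' : (N')⁻¹ ≤ k := by rw [inv_le_comm₀ hN'p hkpos]; exact hN'lo
  have hS := sum_sq_sub_le_card s ζ ζ' hk hk' ha
  have hS0 : 0 ≤ ∑ c ∈ s, (ζ' c - ζ c) ^ 2 := Finset.sum_nonneg fun _ _ => sq_nonneg _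
  have hp1 : (N')⁻¹ * ∑ c ∈ s, (ζ' c - ζ c) ^ 2 ≤ k * (2 * k * a ^ 2) := mul_le_mul hinvN' hS hS0 hkpos.le
  have hp2 : D ^ 2 * N ≤ (k : ℝ) ^ 3 * a ^ 2 * 1 := mul_le_mul hD2 hNhi hNp.le (by positivity)
  nlinarith [hp1, hp2]

end RealFamily

end Summit.QuantumFields.YangMills.Theorems.Prop7LODCutoffRealFamily

end
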